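import Summits.HodgeConjecture.Ring2.RowFourTypeIIOverQ
import Literature.AlgebraicGeometry.HodgeTheory.SymplecticHodgeGroupPowersHodgeClasses
import HarnessLib

/-!
# Ring 2 (cell topic `Summits/HodgeConjecture/Ring2/`; seat `lit`, gen 72, R49-F4): TYPE I(1) WITH SYMPLECTIC HODGE LIE ALGEBRA LEAVES THE ROW-FOUR RESIDUAL — an abelian variety whose complexified Hodge Lie algebra contains every `ψ_ℂ`-skew operator (`Hg = Sp`) is unconditionally divisorial in all codimensions and all powers; an abelian FOURFOLD with `End⁰ = ℚ` is either of this kind or in the MUMFORD POSITION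

HONEST FRAMING (cell `pub-hodge-ring2`, verbatim): research route conditional on HC_CM; not a corollary;
Q11.4-sentence-2 already refuted in dim ≥ 3. `HC_CM` does NOT occur in this file. Markman's theorem
(`Markman2025_weilClasses_algebraic_abelianFourfold`) is a HYPOTHESIS of the axis theorems of §2, never asserted.
Theorems only — no definition, no named fact, no `sorry`. The instance hypothesis `[HodgeTensorFacts.{0, 0}]`
(through which the tree's Hodge Lie algebra `HodgeStructure.hodgeLieC` is defined) is the tree's theorem
`hodgeTensorFacts_holds`; the real Hodge model is the tree's theorem `exists_isReal_hodgeModel_holds`.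

THE PRINT. B. Moonen, Yu. Zarhin, *Hodge classes on abelian varieties of low dimension*, Math. Ann. **315** (1999),
Thm. (0.1)(3) [held text `paper:arxiv-math_9901113` p. 1, L112–118]: «Suppose we are in case (d) [`X` simple of
dimension 4 with `End⁰(X) = ℚ`]. Then `B•(X) = D•(X)`. Either `Hg(X) = Sp(V,φ)`, in which case `B•(Xⁿ) = D•(Xⁿ)` for
all `n`, or `Hg(X)` is isogenous to a `ℚ`-form of `SL₂ × SL₂ × SL₂`, in which case there are exceptional Hodge classes
in `B²(X²)`»; §1 (1.8) «`Hg(X) = Sp_D(V,φ)` ⟺ … ⟺ `D(Xⁿ) = B(Xⁿ)` for all `n`»; §2 (2.5)(1) [p. 5, L142–148] (type I(1):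
the Lie algebra of `Hg` is `𝔰𝔭₈` or `𝔰𝔩₂ × 𝔰𝔩₂ × 𝔰𝔩₂`, Moonen–Zarhin 1995, Duke Math. J. **77**, §2; the second case
occurs, D. Mumford, Math. Ann. **181** (1969), §4).

THIS FILE. Input: the Literature lane's UNCONDITIONAL, CLASSIFICATION-FREE
* `Motives/HodgeThetaSubalgebraSymplecticRankEight` (lit g72 F1: the rank-eight Θ-subalgebra dichotomy by Levi
  operators `BB̄|_{V^{1,0}}` — simple eigenvalue ⟹ `𝔩 = End(V^{1,0})` ⟹ `𝔰𝔭₈`; all Levi operators scalar ⟹ plus line;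
  eigenvalue pattern `(2,2)` ⟹ splitting, pencil / rigidity / orbit lemma ⟹ `𝔰𝔭₈`),
* `Motives/HodgeLieWeightOneRankEightSymplectic` (F2: `HodgeStructure.hodgeLieC_rankEight_dichotomy` — for a polarized
  weight-one Hodge structure of rank 8 with `End_Hdg = ℚ`, `Lie Hg ⊗ ℂ ∋` every `ψ_ℂ`-skew operator OR the MUMFORD
  POSITION; and the rank-generic Theorem L-Sp `HodgeStructure.wordDerAt_eq_zero_of_skew_of_hodgeLieC`),
* `HodgeTheory/SymplecticHodgeGroupPowersHodgeClasses` (F3: `AVSlots.isDivisorGenerated_of_hodgeLieC_sp` — `Hg = Sp`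
  ⟹ `B•(B) = D•(B) ⊗ ℂ` for every `B` with slots over `A`, MZ99 (1.8) direction ⟹, every dimension; and
  `AVSlots.isDivisorGenerated_or_mumford_of_fourfold_endRankOne`).
* §0 the cell, pointwise and UNCONDITIONAL (no Markman, no `HC_CM`), EVERY DIMENSION: `isDivisorGenerated_of_hodgeLieC_sp`,
  `hodgeConjectureFor_of_hodgeLieC_sp`, `hodgeConjectureFor_powSucc_of_hodgeLieC_sp`,
  `isCodimTwoDivisorWeilGenerated_of_hodgeLieC_sp`, `symplecticHodgeLie_hcOnClass`; and the FOURFOLD DICHOTOMY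
  **`hodgeLieC_sp_or_mumford_of_fourfold_endRankOne`**: a complex abelian fourfold with `finrank_ℚ End⁰ = 1` is EITHER
  in the class just closed OR in the Mumford position (a plus pair `B₀, B̄₀` spanning the raising and lowering lines of
  `Lie Hg ⊗ ℂ`, `B₀B̄₀ = μ₀ ≠ 0` on `H^{1,0}`, and `Lie Hg ⊗ ℂ = W ⊕ C`, ideals, `dim W = 3`, `[W, C] = 0`,
  `[W, ⟨B₀, B̄₀, Θ⟩] = 0`).
* §1 **`moonenZarhin1999_codimTwoHodgeClasses_abelianFourfold_iff_residual_noSymplecticTypeIOne`** — the FOURFOLD FACT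
  is EQUIVALENT to `B² ⊆ D² + Σ W_K` on the simple non-CM fourfolds with no imaginary quadratic endomorphism algebra, NOT
  of minimal quaternion type, NOT of maximal real-multiplication type, NOT of real-multiplication type of relative
  dimension two, NOT of type II of quaternion rank two, NOT of quartic CM type `{(1,1),(2,0)}`, and WHOSE COMPLEXIFIED
  HODGE LIE ALGEBRA IS NOT SYMPLECTIC (`¬ ∃ ψ, ∀ Y, Y ψ_ℂ-skew → Y ∈ Lie Hg(H¹(A)) ⊗ ℂ`) — what is left of
  Moonen–Zarhin 1995: type I(1) (`End⁰ = ℚ`) IN THE MUMFORD POSITION (by §0's dichotomy), III over `ℚ`, IV(2,1) `⊇ k`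
  of signature `(2,2)`, IV with `d = 2`.
* §2 **`hcUpToDim_five_iff_rowFour_noSymplecticTypeIOne_of_markman`**,
  `hcAtDim_four_iff_rowFour_noSymplecticTypeIOne_of_markman` — MODULO MARKMAN ALONE, `HCUpToDim 5` / `HCAtDim 4` are
  EQUIVALENT to the Hodge conjecture on that residual class; `rowFourNoSymplecticTypeIOne_hcOnClass_of_hodgeConjecture`
  (on path).

WHAT IS NOT CLAIMED: the residual is NOT closed (type III over `ℚ` carries exceptional classes; `End⁰ = ℚ` fourfolds in
the Mumford position exist, Mumford 1969 §4, and carry exceptional classes on `X²`, MZ99 (0.1)(3)); `B•(X) = D•(X)` for a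
fourfold in the Mumford position (printed in MZ99 (0.1)(3)) is NOT formalized here; Markman is never asserted; no `HC_CM`.

## References
* [MoonenZarhin1999LowDim] B. Moonen, Yu. Zarhin, Math. Ann. 315 (1999), Thm. (0.1)(3), §1 (1.8), §2 (2.2)–(2.5).
* [MoonenZarhin1995Duke] B. Moonen, Yu. Zarhin, Duke Math. J. 77 (1995), §2 (type I(1)).
* [Mumford1969NoteShimura] D. Mumford, Math. Ann. 181 (1969), §4.
* [Gordon1997] B. B. Gordon, arXiv:alg-geom/9709030, §6, Thm. 7.5.
* [vanGeemen1994HodgeAV] B. van Geemen, LNM 1594 (1994), Lemma 3.7, Thm. 4.2, Thm. 4.6.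
* [Deligne2000] P. Deligne, *The Hodge conjecture* (Clay problem description, 2000), §1.
* [claim: Markman2025SurveySecant, status: under-review] E. Markman, arXiv:2509.23403, Thm. 1.2.
-/

noncomputable section

open CategoryTheory CategoryTheory.Limits
open scoped TensorProduct

namespace Summit.HodgeConjecture.Ring2.RowFourTypeIOneSymplectic

open Literature.AlgebraicGeometry.Motives (AbelianVariety bettiCohomology HodgeTensorFacts IsSmoothProjective)
open Literature.AlgebraicGeometry.Motives.AbelianVariety
open Literature.AlgebraicGeometry.Motives.HodgeStructure (hodgeLieC_rankEight_dichotomy)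
open Literature.AlgebraicGeometry.HodgeTheory
open Literature.AlgebraicGeometry.ComplexMultiplication
open Literature.AlgebraicGeometry.Milne1999
open NumberField
open Literature.NumberTheory.Automorphic (IsQuaternionAlgebra)
open Literature.RingTheory.CentralSimple
open Summit.HodgeConjecture.HodgeConjecture.Ring2.ClassTargets
open Summit.HodgeConjecture.Ring2.FivefoldFactHolds
open Summit.HodgeConjecture.Ring2.NonSimpleFourfoldsCodimTwo
open Summit.HodgeConjecture.Ring2.RowFourTypeIVOneOne
open Summit.HodgeConjecture.Ring2.RowFourTypeITwo
open Summit.HodgeConjecture.Ring2.RowFourTypeIIOverQ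

variable [HodgeTensorFacts.{0, 0}] {X : AbelianVariety ℂ}

/-! ### §0 The cell: symplectic Hodge Lie algebra, unconditionally; the fourfold dichotomy -/

/-- **`B•(X) = D•(X) ⊗ ℂ` (`IsDivisorGenerated X`) for every complex abelian variety whose complexified Hodge Lie algebra
contains every `ψ_ℂ`-skew operator (`Hg(X) = Sp(H¹(X;ℚ), ψ)`) — UNCONDITIONAL, every dimension**; the Literature lane's
`AVSlots.isDivisorGenerated_of_hodgeLieC_sp` at the slot `X` itself. MZ99 (1.8) «`Hg(X) = Sp_D(V,φ)` ⟺ … `D(Xⁿ) = B(Xⁿ)`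
for all `n`» (`D = ℚ`, direction ⟹). [cite: MoonenZarhin1999LowDim, §1 (1.8)] [cite: vanGeemen1994HodgeAV, Thm. 4.2] -/
theorem isDivisorGenerated_of_hodgeLieC_sp
    (ψ : (BettiUniverse.hodge exists_isReal_hodgeModel_holds (isSmoothProjective_holds (A := X)) 1).Polarization)
    (hsp : ∀ Y : Module.End ℂ (ℂ ⊗[ℚ] bettiCohomology X.X 1),
      (∀ x y, ψ.form.baseChange ℂ (Y x) y + ψ.form.baseChange ℂ x (Y y) = 0) →
        Y ∈ (BettiUniverse.hodge exists_isReal_hodgeModel_holds (isSmoothProjective_holds (A := X)) 1).hodgeLieC) :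
    IsDivisorGenerated X :=
  (avSlots_self X).isDivisorGenerated_of_hodgeLieC_sp exists_isReal_hodgeModel_holds
    hodgePQ_independent_of_hodgeModel_holds ψ hsp

/-- **The Hodge conjecture for every complex abelian variety with symplectic Hodge Lie algebra — UNCONDITIONAL.**
[cite: MoonenZarhin1999LowDim, §1 (1.8)] [cite: vanGeemen1994HodgeAV, Thm. 4.6] -/
theorem hodgeConjectureFor_of_hodgeLieC_sp
    (ψ : (BettiUniverse.hodge exists_isReal_hodgeModel_holds (isSmoothProjective_holds (A := X)) 1).Polarization)
    (hsp : ∀ Y : Module.End ℂ (ℂ ⊗[ℚ] bettiCohomology X.X 1),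
      (∀ x y, ψ.form.baseChange ℂ (Y x) y + ψ.form.baseChange ℂ x (Y y) = 0) →
        Y ∈ (BettiUniverse.hodge exists_isReal_hodgeModel_holds (isSmoothProjective_holds (A := X)) 1).hodgeLieC) :
    HodgeConjectureFor X.dim X.X :=
  hodgeConjectureFor_of_isDivisorGenerated X (isDivisorGenerated_of_hodgeLieC_sp ψ hsp)

/-- **All powers**: the Hodge conjecture for `X^{N+1}` for such an `X` — UNCONDITIONAL («in which case `B•(Xⁿ) = D•(Xⁿ)`
for all `n`»). [cite: MoonenZarhin1999LowDim, Thm. (0.1)(3) and §1 (1.8)] [cite: vanGeemen1994HodgeAV, Thm. 4.6] -/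
theorem hodgeConjectureFor_powSucc_of_hodgeLieC_sp
    (ψ : (BettiUniverse.hodge exists_isReal_hodgeModel_holds (isSmoothProjective_holds (A := X)) 1).Polarization)
    (hsp : ∀ Y : Module.End ℂ (ℂ ⊗[ℚ] bettiCohomology X.X 1),
      (∀ x y, ψ.form.baseChange ℂ (Y x) y + ψ.form.baseChange ℂ x (Y y) = 0) →
        Y ∈ (BettiUniverse.hodge exists_isReal_hodgeModel_holds (isSmoothProjective_holds (A := X)) 1).hodgeLieC)
    (N : ℕ) : HodgeConjectureFor (X.powSucc N).dim (X.powSucc N).X :=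
  (Literature.AlgebraicGeometry.HodgeTheory.hodgeConjectureFor_powSucc_of_hodgeLieC_sp X
    exists_isReal_hodgeModel_holds hodgePQ_independent_of_hodgeModel_holds ψ hsp N).2

/-- **`B² ⊆ D² (+ Σ W_K)`** for such an `X` (all codimensions are divisorial). [cite: MoonenZarhin1999LowDim, §1 (1.8) and Thm. 0.1] -/
theorem isCodimTwoDivisorWeilGenerated_of_hodgeLieC_sp
    (ψ : (BettiUniverse.hodge exists_isReal_hodgeModel_holds (isSmoothProjective_holds (A := X)) 1).Polarization)
    (hsp : ∀ Y : Module.End ℂ (ℂ ⊗[ℚ] bettiCohomology X.X 1),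
      (∀ x y, ψ.form.baseChange ℂ (Y x) y + ψ.form.baseChange ℂ x (Y y) = 0) →
        Y ∈ (BettiUniverse.hodge exists_isReal_hodgeModel_holds (isSmoothProjective_holds (A := X)) 1).hodgeLieC) :
    IsCodimTwoDivisorWeilGenerated X :=
  (isDivisorGenerated_of_hodgeLieC_sp ψ hsp).isCodimTwoDivisorWeilGenerated

/-- **The class of complex abelian varieties with symplectic Hodge Lie algebra is a CLOSED class target, unconditionally**
(`HCOnClass`, no Markman, no `HC_CM`). [cite: MoonenZarhin1999LowDim, §1 (1.8)] [cite: vanGeemen1994HodgeAV, Thm. 4.6] -/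
theorem symplecticHodgeLie_hcOnClass :
    HCOnClass fun A => ∃ ψ : (BettiUniverse.hodge exists_isReal_hodgeModel_holds (isSmoothProjective_holds (A := A)) 1).Polarization,
      ∀ Y : Module.End ℂ (ℂ ⊗[ℚ] bettiCohomology A.X 1),
        (∀ x y, ψ.form.baseChange ℂ (Y x) y + ψ.form.baseChange ℂ x (Y y) = 0) →
          Y ∈ (BettiUniverse.hodge exists_isReal_hodgeModel_holds (isSmoothProjective_holds (A := A)) 1).hodgeLieC := by
  rintro A ⟨ψ, hsp⟩
  exact hodgeConjectureFor_of_hodgeLieC_sp ψ hsp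

/-- **On path**: the class is a case of the summit. [cite: Deligne2000, §1] -/
theorem symplecticHodgeLie_hcOnClass_of_hodgeConjecture (h : _root_.HodgeConjecture) :
    HCOnClass fun A => ∃ ψ : (BettiUniverse.hodge exists_isReal_hodgeModel_holds (isSmoothProjective_holds (A := A)) 1).Polarization,
      ∀ Y : Module.End ℂ (ℂ ⊗[ℚ] bettiCohomology A.X 1),
        (∀ x y, ψ.form.baseChange ℂ (Y x) y + ψ.form.baseChange ℂ x (Y y) = 0) →
          Y ∈ (BettiUniverse.hodge exists_isReal_hodgeModel_holds (isSmoothProjective_holds (A := A)) 1).hodgeLieC :=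
  hcOnClass_of_hodgeConjecture _ h

/-- **THE FOURFOLD DICHOTOMY (Moonen–Zarhin 1999 Thm. (0.1)(3), §2 (2.5)(1)), at the level of the abelian variety.** A
complex abelian FOURFOLD `X` with `finrank_ℚ End⁰(X) = 1`, `ψ` a polarization of `H = H¹(X(ℂ); ℚ)`: EITHER
`Lie Hg(H) ⊗ ℂ` contains every `ψ_ℂ`-skew operator («`Hg(X) = Sp(V,φ)`»: `X` is in the class closed in this §), OR
`Lie Hg(H) ⊗ ℂ` is in the MUMFORD POSITION: a Hodge operator `Θ`, a raising `B₀ ≠ 0` with conjugate `C₀ = B̄₀` spanning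
the raising and lowering lines, `B₀C₀ = μ₀ ≠ 0` real on `H^{1,0}`, `C₀B₀ = μ₀` on `H^{0,1}`, and `Lie Hg ⊗ ℂ = W ⊕ C`
into ideals with `dim W = 3`, `[W, C] = 0`, `[W, ⟨B₀, C₀, Θ⟩] = 0` («or `Hg(X)` is isogenous to a `ℚ`-form of
`SL₂ × SL₂ × SL₂`»; the case occurs, Mumford 1969 §4). PROOF: `dim_ℚ H¹ = 8`, `End_Hdg(H¹) = ℚ`
(`exists_eq_smul_one_of_finrank_endAlgebra_eq_one`), `HodgeStructure.hodgeLieC_rankEight_dichotomy`.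
[cite: MoonenZarhin1999LowDim, Thm. (0.1)(3) and §2 (2.5)(1)] [cite: MoonenZarhin1995Duke, §2 (type I(1))]
[cite: Mumford1969NoteShimura, §4] -/
theorem hodgeLieC_sp_or_mumford_of_fourfold_endRankOne (h1 : Module.finrank ℚ X.endAlgebra = 1) (h4 : X.dim = 4)
    (ψ : (BettiUniverse.hodge exists_isReal_hodgeModel_holds (isSmoothProjective_holds (A := X)) 1).Polarization) :
    (∀ Y : Module.End ℂ (ℂ ⊗[ℚ] bettiCohomology X.X 1),
      (∀ x y, ψ.form.baseChange ℂ (Y x) y + ψ.form.baseChange ℂ x (Y y) = 0) →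
        Y ∈ (BettiUniverse.hodge exists_isReal_hodgeModel_holds (isSmoothProjective_holds (A := X)) 1).hodgeLieC) ∨
    ∃ Θ B₀ C₀ : Module.End ℂ (ℂ ⊗[ℚ] bettiCohomology X.X 1), ∃ μ₀ : ℂ,
      (∀ p, ∀ x ∈ (BettiUniverse.hodge exists_isReal_hodgeModel_holds (isSmoothProjective_holds (A := X)) 1).piece p (1 - p),
        Θ x = ((2 * p - 1 : ℤ) : ℂ) • x) ∧
      Θ ∈ (BettiUniverse.hodge exists_isReal_hodgeModel_holds (isSmoothProjective_holds (A := X)) 1).hodgeLieC ∧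
      B₀ ∈ (BettiUniverse.hodge exists_isReal_hodgeModel_holds (isSmoothProjective_holds (A := X)) 1).hodgeLieC ∧
      C₀ ∈ (BettiUniverse.hodge exists_isReal_hodgeModel_holds (isSmoothProjective_holds (A := X)) 1).hodgeLieC ∧ B₀ ≠ 0 ∧
      (∀ p ∈ (BettiUniverse.hodge exists_isReal_hodgeModel_holds (isSmoothProjective_holds (A := X)) 1).piece 1 0, B₀ p = 0) ∧
      (∀ v, B₀ v ∈ (BettiUniverse.hodge exists_isReal_hodgeModel_holds (isSmoothProjective_holds (A := X)) 1).piece 1 0) ∧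
      (∀ v, C₀ v = Literature.AlgebraicGeometry.Motives.HodgeStructure.conj
        (B₀ (Literature.AlgebraicGeometry.Motives.HodgeStructure.conj v))) ∧
      (∀ q ∈ (BettiUniverse.hodge exists_isReal_hodgeModel_holds (isSmoothProjective_holds (A := X)) 1).piece 0 1, C₀ q = 0) ∧
      (∀ v, C₀ v ∈ (BettiUniverse.hodge exists_isReal_hodgeModel_holds (isSmoothProjective_holds (A := X)) 1).piece 0 1) ∧
      μ₀ ≠ 0 ∧ starRingEnd ℂ μ₀ = μ₀ ∧
      (∀ p ∈ (BettiUniverse.hodge exists_isReal_hodgeModel_holds (isSmoothProjective_holds (A := X)) 1).piece 1 0,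
        B₀ (C₀ p) = μ₀ • p) ∧
      (∀ q ∈ (BettiUniverse.hodge exists_isReal_hodgeModel_holds (isSmoothProjective_holds (A := X)) 1).piece 0 1,
        C₀ (B₀ q) = μ₀ • q) ∧
      (∀ B' ∈ (BettiUniverse.hodge exists_isReal_hodgeModel_holds (isSmoothProjective_holds (A := X)) 1).hodgeLieC,
        (∀ p ∈ (BettiUniverse.hodge exists_isReal_hodgeModel_holds (isSmoothProjective_holds (A := X)) 1).piece 1 0,
          B' p = 0) →
        (∀ v, B' v ∈ (BettiUniverse.hodge exists_isReal_hodgeModel_holds (isSmoothProjective_holds (A := X)) 1).piece 1 0) →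
        ∃ c : ℂ, B' = c • B₀) ∧
      (∀ C' ∈ (BettiUniverse.hodge exists_isReal_hodgeModel_holds (isSmoothProjective_holds (A := X)) 1).hodgeLieC,
        (∀ q ∈ (BettiUniverse.hodge exists_isReal_hodgeModel_holds (isSmoothProjective_holds (A := X)) 1).piece 0 1,
          C' q = 0) →
        (∀ v, C' v ∈ (BettiUniverse.hodge exists_isReal_hodgeModel_holds (isSmoothProjective_holds (A := X)) 1).piece 0 1) →
        ∃ c : ℂ, C' = c • C₀) ∧
      ∃ W C : Submodule ℂ (Module.End ℂ (ℂ ⊗[ℚ] bettiCohomology X.X 1)),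
        W ≤ (BettiUniverse.hodge exists_isReal_hodgeModel_holds (isSmoothProjective_holds (A := X)) 1).hodgeLieC ∧
        C ≤ (BettiUniverse.hodge exists_isReal_hodgeModel_holds (isSmoothProjective_holds (A := X)) 1).hodgeLieC ∧
        W ⊓ C = ⊥ ∧
        W ⊔ C = (BettiUniverse.hodge exists_isReal_hodgeModel_holds (isSmoothProjective_holds (A := X)) 1).hodgeLieC ∧
        Module.finrank ℂ W = 3 ∧
        (∀ Y ∈ (BettiUniverse.hodge exists_isReal_hodgeModel_holds (isSmoothProjective_holds (A := X)) 1).hodgeLieC,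
          ∀ w ∈ W, Y * w - w * Y ∈ W) ∧
        (∀ Y ∈ (BettiUniverse.hodge exists_isReal_hodgeModel_holds (isSmoothProjective_holds (A := X)) 1).hodgeLieC,
          ∀ c ∈ C, Y * c - c * Y ∈ C) ∧
        (∀ w ∈ W, ∀ c ∈ C, w * c = c * w) ∧
        (∀ w ∈ W, ∀ s ∈ Submodule.span ℂ (Set.range ![B₀, C₀, Θ]), w * s = s * w) := by
  haveI : Module.Finite ℚ (bettiCohomology X.X 1) := finite_bettiCohomology_one X
  have hX : IsSmoothProjective X.dim X.X := isSmoothProjective_holds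
  have heff := BettiUniverse.hodge_isEffective exists_isReal_hodgeModel_holds hX 1
  have hV : Module.finrank ℚ (bettiCohomology X.X 1) = 8 := by rw [finrank_bettiCohomology_one X, h4]
  have hE := exists_eq_smul_one_of_finrank_endAlgebra_eq_one (A := X) exists_isReal_hodgeModel_holds
    hodgePQ_independent_of_hodgeModel_holds h1 (by omega)
  rcases hodgeLieC_rankEight_dichotomy
      (BettiUniverse.hodge exists_isReal_hodgeModel_holds (isSmoothProjective_holds (A := X)) 1)
      Nat.cast_one heff ψ hE hV with hsp | hmum
  · exact Or.inl hsp
  · right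
    simpa only [Nat.cast_one] using hmum

/-! ### §1 The fourfold fact localised past the symplectic type I(1) fourfolds -/

/-- **THE RESIDUAL OF THE FOURFOLD FACT, SEVENTH REFINEMENT — SYMPLECTIC HODGE LIE ALGEBRA REMOVED.** The named fact
`MoonenZarhin1999_codimTwoHodgeClasses_abelianFourfold` (Thm. 0.1 in codimension two) is EQUIVALENT to its instances at
the simple non-CM fourfolds whose endomorphism algebra is NOT an imaginary quadratic field, which are NOT of minimal
quaternion type, NOT of maximal real-multiplication type, NOT of real-multiplication type of relative dimension two, NOT
of type II of quaternion rank two, NOT of quartic CM type `{(1,1),(2,0)}`, and whose complexified Hodge Lie algebra is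
NOT SYMPLECTIC (`¬ ∃ ψ, ∀ Y, Y ψ_ℂ-skew → Y ∈ Lie Hg(H¹(A)) ⊗ ℂ`): by §0 the symplectic ones are UNCONDITIONALLY
divisorial, and by `hodgeLieC_sp_or_mumford_of_fourfold_endRankOne` the type I(1) fourfolds (`End⁰ = ℚ`) that remain are
exactly those in the Mumford position. [cite: MoonenZarhin1999LowDim, Thm. (0.1)(3), §1 (1.8), §2 (2.2)–(2.5)]
[cite: MoonenZarhin1995Duke, §2 (type I(1))] [cite: Mumford1969NoteShimura, §4] -/
theorem moonenZarhin1999_codimTwoHodgeClasses_abelianFourfold_iff_residual_noSymplecticTypeIOne :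
    MoonenZarhin1999_codimTwoHodgeClasses_abelianFourfold ↔
      ∀ A : AbelianVariety ℂ, A.dim = 4 → A.IsSimple → ¬ IsOfCMType A →
        (¬ ∃ (φ : A ⟶ A) (d : ℕ), 0 < d ∧ φ ≫ φ = -(d • 𝟙 A) ∧ Module.finrank ℚ A.endAlgebra = 2) →
        (¬ ∃ (K : Type) (_ : Field K) (_ : NumberField K) (_ : IsTotallyReal K) (_ : Algebra K A.endAlgebra)
          (_ : IsScalarTower ℚ K A.endAlgebra) (_ : IsQuaternionAlgebra K A.endAlgebra),
            A.dim = 2 * Module.finrank ℚ K) →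
        (¬ ∃ hF : IsField A.endAlgebra, NumberField.IsTotallyReal (EndField A hF) ∧
          Module.finrank ℚ A.endAlgebra = A.dim) →
        (¬ ∃ hF : IsField A.endAlgebra, NumberField.IsTotallyReal (EndField A hF) ∧
          2 * Module.finrank ℚ A.endAlgebra = A.dim) →
        (¬ ∃ (K : Type) (_ : Field K) (_ : NumberField K) (_ : IsTotallyReal K) (_ : Algebra K A.endAlgebra)
          (_ : IsScalarTower ℚ K A.endAlgebra) (_ : IsQuaternionAlgebra K A.endAlgebra),
            IsTotallyIndefinite K A.endAlgebra ∧ A.dim = 4 * Module.finrank ℚ K) →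
        (¬ ∃ (φ : A ⟶ A) (μ₁ μ₂ : ℂ), Module.finrank ℚ A.endAlgebra = 4 ∧ starRingEnd ℂ μ₁ ≠ μ₁ ∧
          starRingEnd ℂ μ₂ ≠ μ₂ ∧ μ₂ ≠ μ₁ ∧ μ₂ ≠ starRingEnd ℂ μ₁ ∧ eigenMultiplicity A φ μ₁ = 1 ∧
          eigenMultiplicity A φ (starRingEnd ℂ μ₁) = 1 ∧ eigenMultiplicity A φ μ₂ = 2) →
        (¬ ∃ ψ : (BettiUniverse.hodge exists_isReal_hodgeModel_holds (isSmoothProjective_holds (A := A)) 1).Polarization,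
          ∀ Y : Module.End ℂ (ℂ ⊗[ℚ] bettiCohomology A.X 1),
            (∀ x y, ψ.form.baseChange ℂ (Y x) y + ψ.form.baseChange ℂ x (Y y) = 0) →
              Y ∈ (BettiUniverse.hodge exists_isReal_hodgeModel_holds (isSmoothProjective_holds (A := A)) 1).hodgeLieC) →
        IsCodimTwoDivisorWeilGenerated A := by
  rw [moonenZarhin1999_codimTwoHodgeClasses_abelianFourfold_iff_residual_noTypeIIRankTwo]
  refine ⟨fun h A hA hs hcm hK hQ hT hR hII hC _ => h A hA hs hcm hK hQ hT hR hII hC,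
    fun h A hA hs hcm hK hQ hT hR hII hC => ?_⟩
  by_cases hSp : ∃ ψ : (BettiUniverse.hodge exists_isReal_hodgeModel_holds (isSmoothProjective_holds (A := A)) 1).Polarization,
      ∀ Y : Module.End ℂ (ℂ ⊗[ℚ] bettiCohomology A.X 1),
        (∀ x y, ψ.form.baseChange ℂ (Y x) y + ψ.form.baseChange ℂ x (Y y) = 0) →
          Y ∈ (BettiUniverse.hodge exists_isReal_hodgeModel_holds (isSmoothProjective_holds (A := A)) 1).hodgeLieC
  · obtain ⟨ψ, hsp⟩ := hSp
    exact isCodimTwoDivisorWeilGenerated_of_hodgeLieC_sp ψ hsp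
  exact h A hA hs hcm hK hQ hT hR hII hC hSp

/-! ### §2 The HC axis modulo MARKMAN ALONE: row four without types IV(1,1), I(2), II over `ℚ` and symplectic I(1) -/

/-- **`HCUpToDim 5` MODULO MARKMAN ALONE, TYPES IV(1,1), I(2), II OVER `ℚ` AND SYMPLECTIC I(1) REMOVED**: granted
`Markman2025_weilClasses_algebraic_abelianFourfold` (hypothesis; no `HC_CM`), the Hodge conjecture for all complex abelian
varieties of dimension `≤ 5` is EQUIVALENT to the Hodge conjecture on the simple non-CM FOURFOLDS whose endomorphism
algebra is NOT an imaginary quadratic field, which are of none of the five types minimal quaternion, maximal real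
multiplication, real multiplication of relative dimension two, type II of quaternion rank two, quartic CM `{(1,1),(2,0)}`,
and whose complexified Hodge Lie algebra is NOT symplectic — what is left of Moonen–Zarhin 1995: type I(1) (`End⁰ = ℚ`)
in the MUMFORD POSITION (`Hg` a `ℚ`-form of `SL₂³`; `hodgeLieC_sp_or_mumford_of_fourfold_endRankOne`), III over `ℚ`,
IV(2,1) `⊇ k` of signature `(2,2)`, IV with `d = 2`. [cite: MoonenZarhin1999LowDim, Thm. 0.1, Thm. 0.2, §1 (1.8) and §2 (2.5)]
[cite: MoonenZarhin1995Duke, §2 (type I(1))] [cite: Mumford1969NoteShimura, §4] [claim: Markman2025SurveySecant, status: under-review] -/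
theorem hcUpToDim_five_iff_rowFour_noSymplecticTypeIOne_of_markman
    (hMark : Markman2025_weilClasses_algebraic_abelianFourfold) :
    HCUpToDim 5 ↔ HCOnClass fun A => A.dim = 4 ∧ A.IsSimple ∧ ¬ IsOfCMType A ∧
      (¬ ∃ (φ : A ⟶ A) (d : ℕ), 0 < d ∧ φ ≫ φ = -(d • 𝟙 A) ∧ Module.finrank ℚ A.endAlgebra = 2) ∧
      (¬ ∃ (K : Type) (_ : Field K) (_ : NumberField K) (_ : IsTotallyReal K) (_ : Algebra K A.endAlgebra)
        (_ : IsScalarTower ℚ K A.endAlgebra) (_ : IsQuaternionAlgebra K A.endAlgebra), A.dim = 2 * Module.finrank ℚ K) ∧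
      (¬ ∃ hF : IsField A.endAlgebra, IsTotallyReal (EndField A hF) ∧ Module.finrank ℚ A.endAlgebra = A.dim) ∧
      (¬ ∃ hF : IsField A.endAlgebra, IsTotallyReal (EndField A hF) ∧ 2 * Module.finrank ℚ A.endAlgebra = A.dim) ∧
      (¬ ∃ (K : Type) (_ : Field K) (_ : NumberField K) (_ : IsTotallyReal K) (_ : Algebra K A.endAlgebra)
        (_ : IsScalarTower ℚ K A.endAlgebra) (_ : IsQuaternionAlgebra K A.endAlgebra),
          IsTotallyIndefinite K A.endAlgebra ∧ A.dim = 4 * Module.finrank ℚ K) ∧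
      (¬ ∃ (φ : A ⟶ A) (μ₁ μ₂ : ℂ), Module.finrank ℚ A.endAlgebra = 4 ∧ starRingEnd ℂ μ₁ ≠ μ₁ ∧
        starRingEnd ℂ μ₂ ≠ μ₂ ∧ μ₂ ≠ μ₁ ∧ μ₂ ≠ starRingEnd ℂ μ₁ ∧ eigenMultiplicity A φ μ₁ = 1 ∧
        eigenMultiplicity A φ (starRingEnd ℂ μ₁) = 1 ∧ eigenMultiplicity A φ μ₂ = 2) ∧
      (¬ ∃ ψ : (BettiUniverse.hodge exists_isReal_hodgeModel_holds (isSmoothProjective_holds (A := A)) 1).Polarization,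
        ∀ Y : Module.End ℂ (ℂ ⊗[ℚ] bettiCohomology A.X 1),
          (∀ x y, ψ.form.baseChange ℂ (Y x) y + ψ.form.baseChange ℂ x (Y y) = 0) →
            Y ∈ (BettiUniverse.hodge exists_isReal_hodgeModel_holds (isSmoothProjective_holds (A := A)) 1).hodgeLieC) := by
  rw [hcUpToDim_five_iff_rowFour_noTypeIIRankTwo_of_markman hMark]
  refine ⟨fun h => hcOnClass_mono (fun A hA => ⟨hA.1, hA.2.1, hA.2.2.1, hA.2.2.2.1, hA.2.2.2.2.1, hA.2.2.2.2.2.1,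
      hA.2.2.2.2.2.2.1, hA.2.2.2.2.2.2.2.1, hA.2.2.2.2.2.2.2.2.1⟩) h, fun h A hA => ?_⟩
  obtain ⟨hA4, hs, hcm, hK, hQ, hT, hR, hII, hC⟩ := hA
  by_cases hSp : ∃ ψ : (BettiUniverse.hodge exists_isReal_hodgeModel_holds (isSmoothProjective_holds (A := A)) 1).Polarization,
      ∀ Y : Module.End ℂ (ℂ ⊗[ℚ] bettiCohomology A.X 1),
        (∀ x y, ψ.form.baseChange ℂ (Y x) y + ψ.form.baseChange ℂ x (Y y) = 0) →
          Y ∈ (BettiUniverse.hodge exists_isReal_hodgeModel_holds (isSmoothProjective_holds (A := A)) 1).hodgeLieC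
  · obtain ⟨ψ, hsp⟩ := hSp
    exact hodgeConjectureFor_of_hodgeLieC_sp ψ hsp
  exact h A ⟨hA4, hs, hcm, hK, hQ, hT, hR, hII, hC, hSp⟩

/-- **`HCAtDim 4` MODULO MARKMAN, TYPES IV(1,1), I(2), II OVER `ℚ` AND SYMPLECTIC I(1) REMOVED** (the row-`4` cell alone).
[cite: MoonenZarhin1999LowDim, Thm. (0.1)(3) and §1 (1.8)] [cite: MoonenZarhin1995Duke, §2 (type I(1))]
[claim: Markman2025SurveySecant, status: under-review] -/
theorem hcAtDim_four_iff_rowFour_noSymplecticTypeIOne_of_markman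
    (hMark : Markman2025_weilClasses_algebraic_abelianFourfold) :
    HCAtDim 4 ↔ HCOnClass fun A => A.dim = 4 ∧ A.IsSimple ∧ ¬ IsOfCMType A ∧
      (¬ ∃ (φ : A ⟶ A) (d : ℕ), 0 < d ∧ φ ≫ φ = -(d • 𝟙 A) ∧ Module.finrank ℚ A.endAlgebra = 2) ∧
      (¬ ∃ (K : Type) (_ : Field K) (_ : NumberField K) (_ : IsTotallyReal K) (_ : Algebra K A.endAlgebra)
        (_ : IsScalarTower ℚ K A.endAlgebra) (_ : IsQuaternionAlgebra K A.endAlgebra), A.dim = 2 * Module.finrank ℚ K) ∧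
      (¬ ∃ hF : IsField A.endAlgebra, IsTotallyReal (EndField A hF) ∧ Module.finrank ℚ A.endAlgebra = A.dim) ∧
      (¬ ∃ hF : IsField A.endAlgebra, IsTotallyReal (EndField A hF) ∧ 2 * Module.finrank ℚ A.endAlgebra = A.dim) ∧
      (¬ ∃ (K : Type) (_ : Field K) (_ : NumberField K) (_ : IsTotallyReal K) (_ : Algebra K A.endAlgebra)
        (_ : IsScalarTower ℚ K A.endAlgebra) (_ : IsQuaternionAlgebra K A.endAlgebra),
          IsTotallyIndefinite K A.endAlgebra ∧ A.dim = 4 * Module.finrank ℚ K) ∧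
      (¬ ∃ (φ : A ⟶ A) (μ₁ μ₂ : ℂ), Module.finrank ℚ A.endAlgebra = 4 ∧ starRingEnd ℂ μ₁ ≠ μ₁ ∧
        starRingEnd ℂ μ₂ ≠ μ₂ ∧ μ₂ ≠ μ₁ ∧ μ₂ ≠ starRingEnd ℂ μ₁ ∧ eigenMultiplicity A φ μ₁ = 1 ∧
        eigenMultiplicity A φ (starRingEnd ℂ μ₁) = 1 ∧ eigenMultiplicity A φ μ₂ = 2) ∧
      (¬ ∃ ψ : (BettiUniverse.hodge exists_isReal_hodgeModel_holds (isSmoothProjective_holds (A := A)) 1).Polarization,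
        ∀ Y : Module.End ℂ (ℂ ⊗[ℚ] bettiCohomology A.X 1),
          (∀ x y, ψ.form.baseChange ℂ (Y x) y + ψ.form.baseChange ℂ x (Y y) = 0) →
            Y ∈ (BettiUniverse.hodge exists_isReal_hodgeModel_holds (isSmoothProjective_holds (A := A)) 1).hodgeLieC) := by
  constructor
  · exact fun h => hcOnClass_mono (fun A hA => hA.1) h
  · intro h
    have h5 : HCUpToDim 5 := (hcUpToDim_five_iff_rowFour_noSymplecticTypeIOne_of_markman hMark).2 h
    exact hcOnClass_mono (fun A (hA : A.dim = 4) => show A.dim ≤ 5 by omega) h5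

/-- **On path**: the residual class is a case of the summit. [cite: Deligne2000, §1] -/
theorem rowFourNoSymplecticTypeIOne_hcOnClass_of_hodgeConjecture (h : _root_.HodgeConjecture) :
    HCOnClass fun A => A.dim = 4 ∧ A.IsSimple ∧ ¬ IsOfCMType A ∧
      (¬ ∃ (φ : A ⟶ A) (d : ℕ), 0 < d ∧ φ ≫ φ = -(d • 𝟙 A) ∧ Module.finrank ℚ A.endAlgebra = 2) ∧
      (¬ ∃ (K : Type) (_ : Field K) (_ : NumberField K) (_ : IsTotallyReal K) (_ : Algebra K A.endAlgebra)
        (_ : IsScalarTower ℚ K A.endAlgebra) (_ : IsQuaternionAlgebra K A.endAlgebra), A.dim = 2 * Module.finrank ℚ K) ∧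
      (¬ ∃ hF : IsField A.endAlgebra, IsTotallyReal (EndField A hF) ∧ Module.finrank ℚ A.endAlgebra = A.dim) ∧
      (¬ ∃ hF : IsField A.endAlgebra, IsTotallyReal (EndField A hF) ∧ 2 * Module.finrank ℚ A.endAlgebra = A.dim) ∧
      (¬ ∃ (K : Type) (_ : Field K) (_ : NumberField K) (_ : IsTotallyReal K) (_ : Algebra K A.endAlgebra)
        (_ : IsScalarTower ℚ K A.endAlgebra) (_ : IsQuaternionAlgebra K A.endAlgebra),
          IsTotallyIndefinite K A.endAlgebra ∧ A.dim = 4 * Module.finrank ℚ K) ∧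
      (¬ ∃ (φ : A ⟶ A) (μ₁ μ₂ : ℂ), Module.finrank ℚ A.endAlgebra = 4 ∧ starRingEnd ℂ μ₁ ≠ μ₁ ∧
        starRingEnd ℂ μ₂ ≠ μ₂ ∧ μ₂ ≠ μ₁ ∧ μ₂ ≠ starRingEnd ℂ μ₁ ∧ eigenMultiplicity A φ μ₁ = 1 ∧
        eigenMultiplicity A φ (starRingEnd ℂ μ₁) = 1 ∧ eigenMultiplicity A φ μ₂ = 2) ∧
      (¬ ∃ ψ : (BettiUniverse.hodge exists_isReal_hodgeModel_holds (isSmoothProjective_holds (A := A)) 1).Polarization,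
        ∀ Y : Module.End ℂ (ℂ ⊗[ℚ] bettiCohomology A.X 1),
          (∀ x y, ψ.form.baseChange ℂ (Y x) y + ψ.form.baseChange ℂ x (Y y) = 0) →
            Y ∈ (BettiUniverse.hodge exists_isReal_hodgeModel_holds (isSmoothProjective_holds (A := A)) 1).hodgeLieC) :=
  hcOnClass_of_hodgeConjecture _ h

end Summit.HodgeConjecture.Ring2.RowFourTypeIOneSymplectic

end
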